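import Summits.ValiantsHypothesis.ValiantsHypothesis.Theorems.SymPencilPerFourInnerRankRows
import Summits.ValiantsHypothesis.ValiantsHypothesis.Theorems.SymPencilPerFourPeeledTZ

/-!
# Route `SymPencil` — inner rank of the `2 | 2` row split of `per_4`, PEELED case: the Hessian
# pencil `𝐇(y) = [per(𝟙; e_b; y; e_l)]` and its Taussky–Zassenhaus witnesses, generic case
# (`--supports` stmt-ValiantsHypothesis-5674 `SdcSuperquadratic`; (8,8) column, memo
# `NOTE-p6g16-5674-R2-peeled-ten.md` §2, "Case A")

* `per_one_single_single` — `per(𝟙; e_b; y; e_l) = σ(y) − y_b − y_l` off the diagonal, `0` on it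
  (the Hessian of the elementary symmetric cubic `e₃`).
* Case A of the cyclic-pencil witnesses: for `h : Fin 4 → K` with `h 0, h 1, h 2` pairwise distinct
  and non-zero and a parameter `t` avoiding three values, the points
  `y₀ = (h₁ + t h₂, −h₀, −t h₀, 0)`, `y₁ = (h₂, 0, −h₀, 0)` of the plane `h^⟂ ∩ {y₃ = 0}` give an
  invertible `P₀ = 𝐇(y₀)` (`det = −4 t h₀² (h₁ + t h₂)((h₁ − h₀) + t (h₂ − h₀))`, the determinant
  splits on `{y₃ = 0}`) and a pencil `P₀⁻¹ 𝐇(y₁)` with the explicit eigenbasis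
  `(0,h₂,h₁,0), (h₂,0,h₀,0), (h₁,h₀,0,0), (1,1,1,−1)` and pairwise distinct eigenvalues
  `h₂/(h₁+th₂), 0, 1/t, (h₂−h₀)/((h₁−h₀)+t(h₂−h₀))`; hence (`…PeeledTZ.eq_zero_of_pencil_eigen`)
  the Taussky–Zassenhaus property `htz` consumed by `…PeeledFactor.factor_of_peeled_ten`
  (`htz_caseA`), plus `exists_good_t` (some `t ∈ {1,2,3}` avoids the forbidden values).

The residual patterns of `h` (memo §2) are NOT in this file.  Honest framing: helper lemmas; no cell
closes; `27 ≤ sdc(per_4) ≤ 29`, the crux and `VP ≠ VNP` untouched.  No definitions, no named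
facts. [folklore]
-/

noncomputable section

-- single-conjunct layout: Sub = Summit, duplicated namespace component intended
set_option linter.dupNamespace false

namespace Summit.ValiantsHypothesis.ValiantsHypothesis.Theorems.SymPencilPerFourPeeledHessian

open Matrix Finset
open Summit.ValiantsHypothesis.ValiantsHypothesis.Theorems.SymPencilPerFourInnerRankRows
open Summit.ValiantsHypothesis.ValiantsHypothesis.Theorems.SymPencilPerFourPeeledTZ

variable {K : Type*} [Field K]

/-- **The Hessian of `e₃`:** `per(𝟙; e_b; y; e_l) = (Σ y) − y_b − y_l` for `b ≠ l` and `0` for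
`b = l`. [folklore] -/
theorem per_one_single_single (y : Fin 4 → K) (b l : Fin 4) :
    (Matrix.of ![(fun _ => (1 : K)), Pi.single b 1, y, Pi.single l 1]).permanent =
      if b = l then 0 else (y 0 + y 1 + y 2 + y 3) - y b - y l := by
  fin_cases b <;> fin_cases l <;> simp [permanent_of_rows] <;> ring

/-! ### Case A: three coordinates of `h` pairwise distinct and non-zero -/

/-- Some `t ∈ {1, 2, 3}` avoids two given values (characteristic `0`). [folklore] -/
theorem exists_good_t [CharZero K] (α β : K) : ∃ t : K, t ≠ 0 ∧ t ≠ α ∧ t ≠ β ∧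
    (t = 1 ∨ t = 2 ∨ t = 3) := by
  by_cases h1 : (1 : K) ≠ α ∧ (1 : K) ≠ β
  · exact ⟨1, one_ne_zero, h1.1, h1.2, Or.inl rfl⟩
  by_cases h2 : (2 : K) ≠ α ∧ (2 : K) ≠ β
  · exact ⟨2, two_ne_zero, h2.1, h2.2, Or.inr (Or.inl rfl)⟩
  by_cases h3 : (3 : K) ≠ α ∧ (3 : K) ≠ β
  · exact ⟨3, three_ne_zero, h3.1, h3.2, Or.inr (Or.inr rfl)⟩
  exfalso
  rw [not_and_or, not_ne_iff, not_ne_iff] at h1 h2 h3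
  have h12 : (1 : K) ≠ 2 := by norm_num
  have h13 : (1 : K) ≠ 3 := by norm_num
  have h23 : (2 : K) ≠ 3 := by norm_num
  rcases h1 with h1 | h1 <;> rcases h2 with h2 | h2 <;> rcases h3 with h3 | h3
  all_goals first
    | exact h12 (h1.trans h2.symm) | exact h13 (h1.trans h3.symm) | exact h23 (h2.trans h3.symm)

/-- **Case A witnesses** (memo §2).  With `y₀ = (h₁ + t h₂, −h₀, −t h₀, 0)` and
`y₁ = (h₂, 0, −h₀, 0)`: both lie in `h^⟂`, `𝐇(y₀)` is invertible, and the pencil `𝐇(y₀)⁻¹𝐇(y₁)` has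
the Taussky–Zassenhaus property. [folklore] -/
theorem htz_caseA [CharZero K] (h : Fin 4 → K) (t : K)
    (h0 : h 0 ≠ 0) (h1 : h 1 ≠ 0) (h2 : h 2 ≠ 0)
    (h01 : h 0 ≠ h 1) (h02 : h 0 ≠ h 2) (h12 : h 1 ≠ h 2)
    (ht : t ≠ 0) (ht1 : h 1 + t * h 2 ≠ 0) (ht2 : (h 1 - h 0) + t * (h 2 - h 0) ≠ 0)
    (P₀ P₁ : Matrix (Fin 4) (Fin 4) K)
    (hP₀ : ∀ b l, P₀ b l = (Matrix.of ![(fun _ => (1 : K)), Pi.single b 1,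
      ![h 1 + t * h 2, -h 0, -(t * h 0), 0], Pi.single l 1]).permanent)
    (hP₁ : ∀ b l, P₁ b l = (Matrix.of ![(fun _ => (1 : K)), Pi.single b 1,
      ![h 2, 0, -h 0, 0], Pi.single l 1]).permanent) :
    (∑ k, ![h 1 + t * h 2, -h 0, -(t * h 0), 0] k * h k = 0) ∧
    (∑ k, ![h 2, 0, -h 0, (0 : K)] k * h k = 0) ∧
    IsUnit P₀.det ∧
    (∀ A : Matrix (Fin 4) (Fin 4) K, Aᵀ = -A →
      A * (P₀⁻¹ * P₁) = (P₀⁻¹ * P₁)ᵀ * A → A = 0) := by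
  -- explicit entries
  have e0 : P₀ = !![0, -(t * h 0), -h 0, -h 0 - t * h 0;
                    -(t * h 0), 0, h 1 + t * h 2, h 1 + t * h 2 - t * h 0;
                    -h 0, h 1 + t * h 2, 0, h 1 + t * h 2 - h 0;
                    -h 0 - t * h 0, h 1 + t * h 2 - t * h 0, h 1 + t * h 2 - h 0, 0] := by
    ext b l; rw [hP₀, per_one_single_single]
    fin_cases b <;> fin_cases l <;> simp <;> ring
  have e1 : P₁ = !![0, -h 0, 0, -h 0;
                    -h 0, 0, h 2, h 2 - h 0;
                    0, h 2, 0, h 2;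
                    -h 0, h 2 - h 0, h 2, 0] := by
    ext b l; rw [hP₁, per_one_single_single]
    fin_cases b <;> fin_cases l <;> simp <;> ring
  -- determinant
  have hunit : IsUnit P₀.det := by
    have s22 : Fin.succAbove (2 : Fin 4) (2 : Fin 3) = 3 := by decide
    have s32 : Fin.succAbove (3 : Fin 4) (2 : Fin 3) = 2 := by decide
    have s12 : Fin.succAbove (1 : Fin 4) (2 : Fin 3) = 3 := by decide
    have hd : P₀.det = -4 * t * h 0 ^ 2 * (h 1 + t * h 2) * ((h 1 - h 0) + t * (h 2 - h 0)) := by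
      rw [e0, Matrix.det_succ_row_zero]
      simp [Fin.sum_univ_succ, Matrix.det_fin_three, s22, s32, s12]
      ring
    rw [hd, isUnit_iff_ne_zero]
    have h4 : (-4 : K) ≠ 0 := by norm_num
    exact mul_ne_zero (mul_ne_zero (mul_ne_zero (mul_ne_zero h4 ht) (pow_ne_zero 2 h0)) ht1) ht2
  refine ⟨by simp [Fin.sum_univ_four]; ring, by simp [Fin.sum_univ_four]; ring, hunit, ?_⟩
  -- the eigenbasis of the pencil
  have hP0inv : P₀ * P₀⁻¹ = 1 := Matrix.mul_nonsing_inv P₀ hunit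
  have hP0inv' : P₀⁻¹ * P₀ = 1 := Matrix.nonsing_inv_mul P₀ hunit
  let v : Fin 4 → Fin 4 → K :=
    ![![0, h 2, h 1, 0], ![h 2, 0, h 0, 0], ![h 1, h 0, 0, 0], ![1, 1, 1, -1]]
  let s : Fin 4 → K :=
    ![h 2 / (h 1 + t * h 2), 0, 1 / t, (h 2 - h 0) / ((h 1 - h 0) + t * (h 2 - h 0))]
  -- cleared eigen-relations `β • P₁ v = α • P₀ v`, then divide
  have key : ∀ (α β : K) (w : Fin 4 → K), β ≠ 0 → β • P₁ *ᵥ w = α • P₀ *ᵥ w →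
      P₁ *ᵥ w = (α / β) • P₀ *ᵥ w := by
    intro α β w hβ hc
    have := congrArg (fun z => β⁻¹ • z) hc
    simp only [smul_smul, inv_mul_cancel₀ hβ, one_smul] at this
    rw [this, div_eq_inv_mul]
  have c0 : (h 1 + t * h 2) • P₁ *ᵥ v 0 = h 2 • P₀ *ᵥ v 0 := by
    ext i; fin_cases i <;> simp [v, e0, e1]
    all_goals ring
  have c1 : (1 : K) • P₁ *ᵥ v 1 = (0 : K) • P₀ *ᵥ v 1 := by
    ext i; fin_cases i <;> simp [v, e0, e1]
    all_goals ring
  have c2 : t • P₁ *ᵥ v 2 = (1 : K) • P₀ *ᵥ v 2 := by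
    ext i; fin_cases i <;> simp [v, e0, e1]
    all_goals ring
  have c3 : ((h 1 - h 0) + t * (h 2 - h 0)) • P₁ *ᵥ v 3 = (h 2 - h 0) • P₀ *ᵥ v 3 := by
    ext i; fin_cases i <;> simp [v, e0, e1]
    all_goals ring
  have hv : ∀ j, P₁ *ᵥ v j = s j • P₀ *ᵥ v j := by
    intro j
    fin_cases j
    · exact key _ _ _ ht1 c0
    · simpa [s] using key _ _ _ one_ne_zero c1
    · exact key _ _ _ ht c2
    · exact key _ _ _ ht2 c3
  -- pairwise distinct eigenvalues
  have n01 : h 2 / (h 1 + t * h 2) ≠ 0 := div_ne_zero h2 ht1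
  have n02 : h 2 / (h 1 + t * h 2) ≠ 1 / t := by
    intro heq; rw [div_eq_div_iff ht1 ht] at heq
    exact h1 (by linear_combination -heq)
  have n03 : h 2 / (h 1 + t * h 2) ≠ (h 2 - h 0) / ((h 1 - h 0) + t * (h 2 - h 0)) := by
    intro heq; rw [div_eq_div_iff ht1 ht2] at heq
    have : h 0 * (h 1 - h 2) = 0 := by linear_combination heq
    rcases mul_eq_zero.1 this with h' | h'
    · exact h0 h'
    · exact h12 (sub_eq_zero.1 h')
  have n12 : (0 : K) ≠ 1 / t := (one_div_ne_zero ht).symm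
  have n13 : (0 : K) ≠ (h 2 - h 0) / ((h 1 - h 0) + t * (h 2 - h 0)) :=
    (div_ne_zero (sub_ne_zero.2 h02.symm) ht2).symm
  have n23 : 1 / t ≠ (h 2 - h 0) / ((h 1 - h 0) + t * (h 2 - h 0)) := by
    intro heq; rw [div_eq_div_iff ht ht2] at heq
    exact h01 (by linear_combination -heq)
  have hs : ∀ i j, i ≠ j → s i ≠ s j := by
    intro i j hij
    fin_cases i <;> fin_cases j
    all_goals first
      | exact absurd rfl hij
      | simpa [s] using n01 | simpa [s] using n01.symm
      | simpa [s] using n02 | simpa [s] using n02.symm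
      | simpa [s] using n03 | simpa [s] using n03.symm
      | simpa [s] using n12 | simpa [s] using n12.symm
      | simpa [s] using n13 | simpa [s] using n13.symm
      | simpa [s] using n23 | simpa [s] using n23.symm
  -- the eigenvectors form a basis (`det = -2 h₀ h₁ h₂`)
  have hVunit : IsUnit (Matrix.of v).det := by
    have s22 : Fin.succAbove (2 : Fin 4) (2 : Fin 3) = 3 := by decide
    have s32 : Fin.succAbove (3 : Fin 4) (2 : Fin 3) = 2 := by decide
    have s12 : Fin.succAbove (1 : Fin 4) (2 : Fin 3) = 3 := by decide
    have hd : (Matrix.of v).det = -(2 * h 0 * h 1 * h 2) := by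
      rw [Matrix.det_succ_row_zero]
      simp [Fin.sum_univ_succ, Matrix.det_fin_three, s22, s12, v]
      ring
    rw [hd, isUnit_iff_ne_zero, neg_ne_zero]
    exact mul_ne_zero (mul_ne_zero (mul_ne_zero two_ne_zero h0) h1) h2
  have hW : (Matrix.of v)⁻¹ * Matrix.of v = 1 := Matrix.nonsing_inv_mul _ hVunit
  intro A hA hAS
  exact eq_zero_of_pencil_eigen A (P₀⁻¹ * P₁) P₀ P₁ hA hAS
    (by rw [← Matrix.mul_assoc, hP0inv, Matrix.one_mul]) P₀⁻¹ hP0inv' v s hv hs (Matrix.of v)⁻¹ hW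

end Summit.ValiantsHypothesis.ValiantsHypothesis.Theorems.SymPencilPerFourPeeledHessian

end
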